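import Mathlib
import HarnessLib
import Summits.NavierStokesRegularity.NavierStokesRegularity.Theses.IsobarTomography
import Literature.Analysis.FluidPDE.SelfSimilarProofs
import Literature.Analysis.FluidPDE.ClassicalSolutionRescale
import Literature.Analysis.FluidPDE.DirectionDissipation
import Summits.NavierStokesRegularity.NavierStokesRegularity.Theorems.IsobarTomographyTubeAlternativeGauge

/-!
# The crux `IsobarTomography.TubeAlternative` (stmt-NavierStokesRegularity-11739) is, unconditionally,
# the implication `IsobaricLinesLiouville → (Type-I solutions satisfy the blob hypothesis)`

Helper file (theorems only) of the line lead c2 for crux D = `TubeAlternative` of route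
`IsobarTomography`, line `analytic-propagation-local-patch`.

The crux is `(∃ antecedent) → C` (`tubeAlternative_iff_exists_antecedent_imp`, p101533) with the
u-free conclusion

  `C : ∃ v q, IsKNSSBlowupLimit v ∧ IsClassicalNSSolutionOn (Iio 0) 1 0 v q ∧ ω_v·∇q ≡ 0 ∧ ¬ slice-constant`.

Earlier calibrations were CONDITIONAL: granted K2 = `IsobaricLinesLiouville`, `D ↔ TypeIForcesBlob`
(lead 0, p101533); granted K1 ∧ K2, `D ↔ NoTypeIBlowup` (lead c1, p121485/p121573). Here the
hypothesis is removed: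

1. `exists_isKNSSBlowupLimit_of_not_sliceConst` — **sup-normalisation.** A bounded ancient mild
   solution `v` (tree = duality form) with a classical pressure `q` on `(-∞,0)` which is not
   slice-wise constant has `M = sup |v| > 0`, and its parabolic rescaling `M⁻¹ v(M⁻² t, M⁻¹ x)`,
   `M⁻² q(M⁻² t, M⁻¹ x)` is a KNSS blow-up limit (`|·| ≤ 1 = sup`, smooth, measurable, duality-mild by
   the PROVED scale invariance `IsAncientMildSolution.nsRescale_holds`) with classical pressure
   (`IsClassicalNSSolutionOn.nsRescale_holds`), still not slice-wise constant, and with isobaric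
   vortex lines if `(v, q)` had them (the defect `⟪curl v, ∇q⟫` is scale covariant).
2. `tubeConclusion_iff_not_isobaricLinesLiouville` — hence **`C ↔ ¬ K2`**: the conclusion of the
   crux is EXACTLY the negation of the route's own rank-4 crux.
3. `tubeAlternative_iff_liouville_imp_typeIForcesBlob` — **`D ↔ (K2 → TypeIForcesBlob)`**, where
   `TypeIForcesBlob` is "every Type-I maximal Leray–Hopf classical solution from a rapidly decaying
   datum satisfies the blob hypothesis" (the negation of the crux's antecedent, written out).
4. `tubeAlternative_or_isobaricLinesLiouville` — in particular **`D ∨ K2` is a theorem**, and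
   `D ∧ K2 ↔ K2 ∧ TypeIForcesBlob`: inside the route (whose `closes` needs D and K2 together) the
   crux D carries no content beyond the conditional-regularity statement `TypeIForcesBlob`.

References: Koch–Nadirashvili–Seregin–Šverák, Acta Math. 203 (2009) = arXiv:0709.3599, §1
(scaling `u ↦ λu(λ²t, λx)`, parasitic solutions, conjecture (L)); Leray 1934 §20 (the scaling).
-/

-- the problem directory repeats the summit name (D-0017); core's `dupNamespace` linter fires
set_option linter.dupNamespace false

noncomputable section

namespace Summit.NavierStokesRegularity.NavierStokesRegularity.Theorems.TubeAlternative

open Set Filter Topology Function MeasureTheory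
open scoped RealInnerProductSpace
open Literature.Analysis Literature.Analysis.FluidPDE
open Summit.NavierStokesRegularity.NavierStokesRegularity.Theses
open Summit.NavierStokesRegularity.NavierStokesRegularity.Theses.IsobarTomography
open Summit.NavierStokesRegularity.NavierStokesRegularity.Theorems

/-! ## 1. Sup-normalisation of a non-slice-constant bounded ancient solution -/

/-- The Navier–Stokes rescaling is an amplitude-`c` pull-back along `(t, x) ↦ (c² t, c x)`:
`nsRescale c u = c • stPull (c * c) c 0 0 u`. [folklore] -/
theorem nsRescale_eq_smul_stPull (c : ℝ) (u : ℝ → (EuclideanSpace ℝ (Fin 3)) → (EuclideanSpace ℝ (Fin 3))) :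
    FluidPDE.nsRescale c u = c • stPull (c * c) c 0 (0 : (EuclideanSpace ℝ (Fin 3))) u := by
  funext t x
  simp [stPull_apply, nsRescale_apply, sq]

/-- The rescaled pressure is `c² • stPull (c * c) c 0 0 p`. [folklore] -/
theorem nsRescalePressure_eq_smul_stPull (c : ℝ) (p : ℝ → (EuclideanSpace ℝ (Fin 3)) → ℝ) :
    nsRescalePressure c p = (c ^ 2) • stPull (c * c) c 0 (0 : (EuclideanSpace ℝ (Fin 3))) p := by
  funext t x
  simp [stPull_apply, nsRescalePressure_apply, sq]

/-- **Scale covariance of the isobaric defect.** For `0 < c` (indeed any `c`), the vorticity of the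
rescaled field and the gradient of the rescaled pressure at `(t, y)` are the multiples `c²` and `c³`
of those of `(v, q)` at `(c² t, c y)`; in particular `⟪curl v, ∇q⟫ ≡ 0` on `t < 0` is inherited.
The pressure slice is assumed differentiable (true for classical pressures). [folklore] -/
theorem inner_curl_gradient_nsRescale {v : ℝ → (EuclideanSpace ℝ (Fin 3)) → (EuclideanSpace ℝ (Fin 3))} {q : ℝ → (EuclideanSpace ℝ (Fin 3)) → ℝ} (c : ℝ) {t : ℝ} {y : (EuclideanSpace ℝ (Fin 3))}
    (hq : DifferentiableAt ℝ (q (c ^ 2 * t)) (c • y)) :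
    ⟪curl (FluidPDE.nsRescale c v t) y, gradient (nsRescalePressure c q t) y⟫ =
      (c * c) * (c ^ 2 * c) * ⟪curl (v (c ^ 2 * t)) (c • y), gradient (q (c ^ 2 * t)) (c • y)⟫ := by
  have hcurl : curl (FluidPDE.nsRescale c v t) y = (c * c) • curl (v (c ^ 2 * t)) (c • y) := by
    rw [nsRescale_eq_smul_stPull, curl_smul_stPull]
    simp [sq]
  have hqd : DifferentiableAt ℝ (stPull (c * c) c 0 (0 : (EuclideanSpace ℝ (Fin 3))) q t) y := by
    have h1 : stPull (c * c) c 0 (0 : (EuclideanSpace ℝ (Fin 3))) q t = fun z => q (c ^ 2 * t) (c • z) := by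
      funext z; simp [stPull_apply, sq]
    rw [h1]
    exact hq.comp y ((differentiableAt_id).const_smul c)
  have hgrad : gradient (nsRescalePressure c q t) y = (c ^ 2 * c) • gradient (q (c ^ 2 * t)) (c • y) := by
    rw [nsRescalePressure_eq_smul_stPull,
      show ((c ^ 2) • stPull (c * c) c 0 (0 : (EuclideanSpace ℝ (Fin 3))) q) t = fun z => (c ^ 2) • stPull (c * c) c 0 (0 : (EuclideanSpace ℝ (Fin 3))) q t z
        from rfl, gradient_const_smul hqd, gradient_stPull, smul_smul]
    simp [sq]
  rw [hcurl, hgrad, inner_smul_left, inner_smul_right]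
  simp only [conj_trivial]
  ring

/-- **Sup-normalisation (KNSS 2009 §1 scaling).** Let `v` be a bounded ancient mild solution
(`ν = 1`, tree duality form) with a classical pressure `q` on `(-∞, 0)`, NOT slice-wise constant.
Then `M = sup_{t<0,x} |v| > 0` and the parabolic rescaling `v'(t, x) = M⁻¹ v(M⁻² t, M⁻¹ x)`,
`q'(t, x) = M⁻² q(M⁻² t, M⁻¹ x)` is a KNSS blow-up limit of the tree's class (`IsKNSSBlowupLimit`:
duality-mild by `IsAncientMildSolution.nsRescale_holds`, smooth and measurable from the classical
structure, `|v'| ≤ 1 = sup |v'|`) with classical pressure, not slice-wise constant; and if the vortex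
lines of `(v, q)` are isobaric (`⟪curl v, ∇q⟫ ≡ 0` on `t < 0`), so are those of `(v', q')`. [folklore] -/
theorem exists_isKNSSBlowupLimit_of_not_sliceConst (v : ℝ → (EuclideanSpace ℝ (Fin 3)) → (EuclideanSpace ℝ (Fin 3))) (q : ℝ → (EuclideanSpace ℝ (Fin 3)) → ℝ)
    (hmild : IsBoundedAncientMildSolution 1 v) (hcl : IsClassicalNSSolutionOn (Set.Iio 0) 1 0 v q)
    (hiso : ∀ t < 0, ∀ x : (EuclideanSpace ℝ (Fin 3)), ⟪curl (v t) x, gradient (q t) x⟫ = 0)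
    (hnc : ¬ (∀ t < 0, ∃ b : (EuclideanSpace ℝ (Fin 3)), v t = fun _ => b)) :
    ∃ (v' : ℝ → (EuclideanSpace ℝ (Fin 3)) → (EuclideanSpace ℝ (Fin 3))) (q' : ℝ → (EuclideanSpace ℝ (Fin 3)) → ℝ), IsKNSSBlowupLimit v' ∧
      IsClassicalNSSolutionOn (Set.Iio 0) 1 0 v' q' ∧
      (∀ t < 0, ∀ x : (EuclideanSpace ℝ (Fin 3)), ⟪curl (v' t) x, gradient (q' t) x⟫ = 0) ∧
      ¬ (∀ t < 0, ∃ b : (EuclideanSpace ℝ (Fin 3)), v' t = fun _ => b) := by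
  -- a non-constant slice `t₀ < 0`, and a point where it is non-zero
  push Not at hnc
  obtain ⟨t₀, ht₀, hne⟩ := hnc
  have hx₀ : ∃ x₀ : (EuclideanSpace ℝ (Fin 3)), v t₀ x₀ ≠ 0 := by
    by_contra h
    push Not at h
    exact hne 0 (funext h)
  obtain ⟨x₀, hx₀⟩ := hx₀
  -- ## the supremum `M` of `‖v‖` over `t < 0`
  obtain ⟨C, hC⟩ := hmild.2
  set M : ℝ := ⨆ z : {z : ℝ × (EuclideanSpace ℝ (Fin 3)) // z.1 < 0}, ‖v z.1.1 z.1.2‖ with hM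
  have hbdd : BddAbove (range fun z : {z : ℝ × (EuclideanSpace ℝ (Fin 3)) // z.1 < 0} => ‖v z.1.1 z.1.2‖) := by
    refine ⟨C, ?_⟩
    rintro _ ⟨z, rfl⟩
    exact hC _ z.2 _
  haveI : Nonempty {z : ℝ × (EuclideanSpace ℝ (Fin 3)) // z.1 < 0} := ⟨⟨(t₀, x₀), ht₀⟩⟩
  have hvM : ∀ t : ℝ, t < 0 → ∀ x, ‖v t x‖ ≤ M := fun t ht x => le_ciSup hbdd ⟨(t, x), ht⟩
  have hM0 : 0 < M := (norm_pos_iff.2 hx₀).trans_le (hvM t₀ ht₀ x₀)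
  -- ## the rescaling by `l = 1/M`
  set l : ℝ := M⁻¹ with hl
  have hl0 : 0 < l := inv_pos.2 hM0
  have hlM : l * M = 1 := inv_mul_cancel₀ hM0.ne'
  have hl2 : 0 < l ^ 2 := pow_pos hl0 2
  have htime : ∀ {t : ℝ}, t < 0 → l ^ 2 * t < 0 := fun ht => mul_neg_of_pos_of_neg hl2 ht
  set v' : ℝ → (EuclideanSpace ℝ (Fin 3)) → (EuclideanSpace ℝ (Fin 3)) := FluidPDE.nsRescale l v with hv'
  set q' : ℝ → (EuclideanSpace ℝ (Fin 3)) → ℝ := nsRescalePressure l q with hq'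
  have hv'_apply : ∀ t x, v' t x = l • v (l ^ 2 * t) (l • x) := fun t x => rfl
  -- classical on `Iio 0`
  have hclv : IsClassicalNSSolutionOn (Set.Iio 0) 1 0 v' q' := by
    have key := IsClassicalNSSolutionOn.nsRescale_holds hcl hl0
    have hS : ((fun t => l ^ 2 * t) ⁻¹' Set.Iio (0 : ℝ)) = Set.Iio 0 := by
      ext t
      simp only [mem_preimage, mem_Iio]
      constructor
      · intro h
        by_contra ht
        exact absurd h (not_lt.2 (mul_nonneg hl2.le (not_lt.1 ht)))
      · exact fun ht => htime ht
    rw [hS, nsRescaleForce_zero] at key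
    exact key
  -- duality-mild and bounded
  have hmild' : IsBoundedAncientMildSolution 1 v' :=
    hmild.nsRescale IsAncientMildSolution.nsRescale_holds one_pos hl0
  -- bounds
  have hle1 : ∀ t < 0, ∀ x, ‖v' t x‖ ≤ 1 := fun t ht x => by
    rw [hv'_apply, norm_smul, Real.norm_of_nonneg hl0.le, ← hlM]
    exact mul_le_mul_of_nonneg_left (hvM _ (htime ht) _) hl0.le
  have hsup : ∀ ε : ℝ, 0 < ε → ∃ t < 0, ∃ x, 1 - ε < ‖v' t x‖ := by
    intro ε hε
    have hlt : M * (1 - ε) < M := by nlinarith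
    obtain ⟨⟨⟨t, x⟩, ht⟩, hlt'⟩ := exists_lt_of_lt_ciSup hlt
    refine ⟨t / l ^ 2, div_neg_of_neg_of_pos ht hl2, l⁻¹ • x, ?_⟩
    rw [hv'_apply, smul_inv_smul₀ hl0.ne', mul_div_cancel₀ _ hl2.ne', norm_smul,
      Real.norm_of_nonneg hl0.le]
    calc 1 - ε = l * (M * (1 - ε)) := by rw [← mul_assoc, hlM, one_mul]
      _ < l * ‖v t x‖ := mul_lt_mul_of_pos_left hlt' hl0
  -- the KNSS blow-up limit structure
  have hknss : IsKNSSBlowupLimit v' :=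
    ⟨hmild', fun t ht => (hclv.contDiff_velocity ht).continuous.aestronglyMeasurable,
      hclv.smooth_velocity, hle1, hsup⟩
  -- isobaric vortex lines are inherited
  have hiso' : ∀ t < 0, ∀ x : (EuclideanSpace ℝ (Fin 3)), ⟪curl (v' t) x, gradient (q' t) x⟫ = 0 := by
    intro t ht x
    have hqd : DifferentiableAt ℝ (q (l ^ 2 * t)) (l • x) :=
      ((hcl.contDiff_pressure (htime ht)).differentiable (by simp)).differentiableAt
    rw [hv', hq', inner_curl_gradient_nsRescale l hqd, hiso _ (htime ht), mul_zero]
  -- not slice-constant: the slice through `t₀` is not constant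
  have hnc' : ¬ (∀ t < 0, ∃ b : (EuclideanSpace ℝ (Fin 3)), v' t = fun _ => b) := by
    intro h
    obtain ⟨b, hb⟩ := h (t₀ / l ^ 2) (div_neg_of_neg_of_pos ht₀ hl2)
    refine hne (l⁻¹ • b) (funext fun y => ?_)
    have h1 := congrFun hb (l⁻¹ • y)
    rw [hv'_apply, smul_inv_smul₀ hl0.ne', mul_div_cancel₀ _ hl2.ne'] at h1
    rw [← h1, inv_smul_smul₀ hl0.ne']
  exact ⟨v', q', hknss, hclv, hiso', hnc'⟩

/-! ## 2. The conclusion of the crux is exactly `¬ IsobaricLinesLiouville` -/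

/-- **`C ↔ ¬ K2`.** The u-free conclusion of `TubeAlternative` (some KNSS blow-up limit with classical
pressure and isobaric vortex lines which is not slice-wise constant) holds if and only if the route's
rank-4 crux `IsobaricLinesLiouville` fails: a witness of `C` is a counterexample to K2
(`not_isobaricLinesLiouville_of_tubeConclusion`, p101533), and a counterexample to K2 sup-normalises
to a witness of `C` (`exists_isKNSSBlowupLimit_of_not_sliceConst`). [folklore] -/
theorem tubeConclusion_iff_not_isobaricLinesLiouville :
    (∃ (v : ℝ → (EuclideanSpace ℝ (Fin 3)) → (EuclideanSpace ℝ (Fin 3))) (q : ℝ → (EuclideanSpace ℝ (Fin 3)) → ℝ), IsKNSSBlowupLimit v ∧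
      IsClassicalNSSolutionOn (Set.Iio 0) 1 0 v q ∧
      (∀ t < 0, ∀ x : (EuclideanSpace ℝ (Fin 3)), inner ℝ (curl (v t) x) (gradient (q t) x) = 0) ∧
      ¬ (∀ t < 0, ∃ b : (EuclideanSpace ℝ (Fin 3)), v t = fun _ => b)) ↔
    ¬ IsobaricLinesLiouville := by
  refine ⟨not_isobaricLinesLiouville_of_tubeConclusion, fun hK => ?_⟩
  unfold IsobaricLinesLiouville at hK
  push Not at hK
  obtain ⟨v, q, hmild, hcl, hiso, t, ht, hne⟩ := hK
  exact exists_isKNSSBlowupLimit_of_not_sliceConst v q hmild hcl hiso fun h => by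
    obtain ⟨b, hb⟩ := h t ht
    exact hne b hb

/-- **`¬ K2 ⟹ D`.** If `IsobaricLinesLiouville` fails, the crux holds outright (its conclusion is
witnessed, whatever the antecedent). [folklore] -/
theorem tubeAlternative_of_not_isobaricLinesLiouville (hK : ¬ IsobaricLinesLiouville) :
    TubeAlternative := fun _ _ _ _ _ _ _ _ _ _ _ =>
  tubeConclusion_iff_not_isobaricLinesLiouville.2 hK

/-- **`D ∨ K2` is a theorem**: at least one of the route's cruxes `TubeAlternative`,
`IsobaricLinesLiouville` holds. [folklore] -/
theorem tubeAlternative_or_isobaricLinesLiouville : TubeAlternative ∨ IsobaricLinesLiouville := by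
  by_cases hK : IsobaricLinesLiouville
  · exact Or.inr hK
  · exact Or.inl (tubeAlternative_of_not_isobaricLinesLiouville hK)

/-! ## 3. The unconditional calibration: `D ↔ (K2 → TypeIForcesBlob)` -/

/-- **`TubeAlternative ↔ (IsobaricLinesLiouville → TypeIForcesBlob)`**, where `TypeIForcesBlob`
(written out) says that every Type-I maximal Leray–Hopf classical solution from a rapidly decaying
datum satisfies the blob hypothesis. (`→`: the tube branch of the route's `closes`,
`blob_of_tubeAlternative_of_isobaricLinesLiouville`; `←`: if K2 holds the antecedent of D is void, if
K2 fails the conclusion of D is witnessed.) So, with no hypothesis at all, the crux D is exactly the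
statement "the route's own Liouville crux K2 implies the conditional-regularity statement
`TypeIForcesBlob`". [folklore] -/
theorem tubeAlternative_iff_liouville_imp_typeIForcesBlob :
    TubeAlternative ↔
      (IsobaricLinesLiouville →
        ∀ (ν T : ℝ), 0 < ν → 0 < T → ∀ (u : ℝ → (EuclideanSpace ℝ (Fin 3)) → (EuclideanSpace ℝ (Fin 3))) (p : ℝ → (EuclideanSpace ℝ (Fin 3)) → ℝ),
          IsMaximalSmoothSolution ν 0 u p T → IsLerayHopfOn T ν 0 (u 0) u →
          HasRapidSpatialDecay (u 0) → IsTypeIBlowup u T →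
          ∃ κ : ℝ, 0 < κ ∧ ∃ Ω : ℝ → ℝ, ∃ t₀ ∈ Set.Ico 0 T, ∀ t ∈ Set.Ico t₀ T,
            (∃ x : (EuclideanSpace ℝ (Fin 3)), Ω t < ‖curl (u t) x‖) ∧ ∀ x : (EuclideanSpace ℝ (Fin 3)), Ω t < ‖curl (u t) x‖ →
              κ * ‖curl (u t) x‖ ^ 2 * Laplacian.laplacian (p t) x ≤
                iteratedFDeriv ℝ 2 (p t) x ![curl (u t) x, curl (u t) x]) := by
  refine ⟨fun hD hK => blob_of_tubeAlternative_of_isobaricLinesLiouville hD hK, fun h => ?_⟩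
  by_cases hK : IsobaricLinesLiouville
  · intro ν T hν hT u p hmax hLH hdec hI hnb
    exact absurd (h hK ν T hν hT u p hmax hLH hdec hI) hnb
  · exact tubeAlternative_of_not_isobaricLinesLiouville hK

/-- **Inside the route: `D ∧ K2 ↔ K2 ∧ TypeIForcesBlob`.** The pair of cruxes the route's `closes`
consumes together is the pair "Liouville for isobaric vortex lines" ∧ "Type-I maximal Leray–Hopf
solutions satisfy the blob hypothesis"; the tomographic selection adds nothing. [folklore] -/
theorem tubeAlternative_and_liouville_iff :
    (TubeAlternative ∧ IsobaricLinesLiouville) ↔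
      (IsobaricLinesLiouville ∧
        ∀ (ν T : ℝ), 0 < ν → 0 < T → ∀ (u : ℝ → (EuclideanSpace ℝ (Fin 3)) → (EuclideanSpace ℝ (Fin 3))) (p : ℝ → (EuclideanSpace ℝ (Fin 3)) → ℝ),
          IsMaximalSmoothSolution ν 0 u p T → IsLerayHopfOn T ν 0 (u 0) u →
          HasRapidSpatialDecay (u 0) → IsTypeIBlowup u T →
          ∃ κ : ℝ, 0 < κ ∧ ∃ Ω : ℝ → ℝ, ∃ t₀ ∈ Set.Ico 0 T, ∀ t ∈ Set.Ico t₀ T,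
            (∃ x : (EuclideanSpace ℝ (Fin 3)), Ω t < ‖curl (u t) x‖) ∧ ∀ x : (EuclideanSpace ℝ (Fin 3)), Ω t < ‖curl (u t) x‖ →
              κ * ‖curl (u t) x‖ ^ 2 * Laplacian.laplacian (p t) x ≤
                iteratedFDeriv ℝ 2 (p t) x ![curl (u t) x, curl (u t) x]) :=
  ⟨fun h => ⟨h.2, tubeAlternative_iff_liouville_imp_typeIForcesBlob.1 h.1 h.2⟩,
    fun h => ⟨tubeAlternative_of_typeI_forces_blob h.2, h.1⟩⟩

/-! ## 4. Registered tools stub -/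

/-- **Registered tools stub `stub_liouvilleGaugeTools`** (`ledger workitem stub-add
stmt-NavierStokesRegularity-11739 --name stub_liouvilleGaugeTools`): `D ∨ K2`; `C ↔ ¬ K2`;
`D ↔ (K2 → TypeIForcesBlob)`. Census/calibration stub of the line lead (c2), not a stub of the line's
composition. [folklore] -/
theorem stub_liouvilleGaugeTools :
    (Summit.NavierStokesRegularity.NavierStokesRegularity.Theses.IsobarTomography.TubeAlternative ∨
      Summit.NavierStokesRegularity.NavierStokesRegularity.Theses.IsobarTomography.IsobaricLinesLiouville) ∧
    ((∃ (v : ℝ → EuclideanSpace ℝ (Fin 3) → EuclideanSpace ℝ (Fin 3))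
        (q : ℝ → EuclideanSpace ℝ (Fin 3) → ℝ),
        Literature.Analysis.FluidPDE.IsKNSSBlowupLimit v ∧
        Literature.Analysis.FluidPDE.IsClassicalNSSolutionOn (Set.Iio 0) 1 0 v q ∧
        (∀ t < 0, ∀ x : EuclideanSpace ℝ (Fin 3),
          inner ℝ (Literature.Analysis.FluidPDE.curl (v t) x) (gradient (q t) x) = 0) ∧
        ¬ (∀ t < 0, ∃ b : EuclideanSpace ℝ (Fin 3), v t = fun _ => b)) ↔
      ¬ Summit.NavierStokesRegularity.NavierStokesRegularity.Theses.IsobarTomography.IsobaricLinesLiouville) ∧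
    (Summit.NavierStokesRegularity.NavierStokesRegularity.Theses.IsobarTomography.TubeAlternative ↔
      (Summit.NavierStokesRegularity.NavierStokesRegularity.Theses.IsobarTomography.IsobaricLinesLiouville →
        ∀ (ν T : ℝ), 0 < ν → 0 < T →
        ∀ (u : ℝ → EuclideanSpace ℝ (Fin 3) → EuclideanSpace ℝ (Fin 3))
          (p : ℝ → EuclideanSpace ℝ (Fin 3) → ℝ),
        Literature.Analysis.FluidPDE.IsMaximalSmoothSolution ν 0 u p T →
        Literature.Analysis.FluidPDE.IsLerayHopfOn T ν 0 (u 0) u →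
        Literature.Analysis.FluidPDE.HasRapidSpatialDecay (u 0) →
        Literature.Analysis.FluidPDE.IsTypeIBlowup u T →
        ∃ κ : ℝ, 0 < κ ∧ ∃ Ω : ℝ → ℝ, ∃ t₀ ∈ Set.Ico 0 T, ∀ t ∈ Set.Ico t₀ T,
          (∃ x : EuclideanSpace ℝ (Fin 3), Ω t < ‖Literature.Analysis.FluidPDE.curl (u t) x‖) ∧
          ∀ x : EuclideanSpace ℝ (Fin 3), Ω t < ‖Literature.Analysis.FluidPDE.curl (u t) x‖ →
            κ * ‖Literature.Analysis.FluidPDE.curl (u t) x‖ ^ 2 * Laplacian.laplacian (p t) x ≤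
              iteratedFDeriv ℝ 2 (p t) x
                ![Literature.Analysis.FluidPDE.curl (u t) x, Literature.Analysis.FluidPDE.curl (u t) x])) :=
  ⟨tubeAlternative_or_isobaricLinesLiouville, tubeConclusion_iff_not_isobaricLinesLiouville,
    tubeAlternative_iff_liouville_imp_typeIForcesBlob⟩

end Summit.NavierStokesRegularity.NavierStokesRegularity.Theorems.TubeAlternative

end
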